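import Summits.RiemannHypothesis.RiemannHypothesis.Theorems.SuzukiWindowsDoorExplicitOpNorm

/-!
# SuzukiWindowsDoorWindowDilation — window operators through plain `ℒ²` functions, the DILATION LEMMA, and two-sided bounds for the onset operator `A_θ` (column DBR; RH-FREE)

LINE 1 — LABEL: RH-FREE, `ζ`-FREE operator theory (K-general §1) and explicit integrals for ONE explicit polynomial kernel
(§2); bears_on: LADDER-RH B-D(b) → B-P(P2) (PROOF-OF-DATA support for DATA.md §ET1f-lite; the small-window law itself is
`SuzukiWindowsDoorSmallWindowLaw`, which imports this file).  WHAT THIS IS NOT: nothing about `ζ`, no window certified or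
moved, the residual `AllWindowsWitness` (stmt-19733) RH-EQUIVALENT and unclaimed; nothing here bears on the truth of RH.

Tree style (`SuzukiWindowsDoorTempleWindow`, `…ExplicitOpNorm`, `…KernelMonotone`): a window operator is ANY bounded `A`
on `L²(−t,t)` with the a.e. kernel formula `(Aφ)(x) = ∫_{(−t,t)} K(x+y)φ(y)dy`; no definition is introduced.

* §1 (K-general) `sq_integral_winOp_le` (`∫(∫Kf)² ≤ ‖A‖²∫f²` for plain `f ∈ ℒ²`), `opNorm_winOp_le_of_forall` (the
  converse bound), the change of variables `setIntegral_win_comp_mul` and `ℒ²` transport `memLp_comp_mul` under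
  `x = cu`, and the **DILATION LEMMA** `opNorm_winOp_eq_dilate`: for `t > 0` the window operator on `L²(−t,t)` with
  kernel `K(x+y)` and the one on `L²(−1,1)` with kernel `t·K(t(u+v))` have the same norm.
* §2 the ONSET OPERATOR `A_θ` (kernel `(u+v)₊^k` on `L²(−1,1)`, `θ = k+1 ≥ 2`; the operator of the small-window law
  `σ₁(θ,t) ≈ c_θ‖A_θ‖t^θ`, DATA §ET1f-lite): `integral_onsetKernel_row` (`∫_{(−1,1)}(u+v)₊^k dv = (u+1)^θ/θ`),
  **`sq_opNorm_onsetOp_ge`** (`‖A_θ‖² ≥ 2^{2θ}/(θ²(2θ+1))`, test function `𝟙`) and **`sq_opNorm_onsetOp_le`**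
  (`‖A_θ‖² ≤ 2^{2θ}/((2θ−1)2θ)`, Hilbert–Schmidt): e.g. `0.894 ≤ ‖A₂‖ ≤ 1.155`, `1.008 ≤ ‖A₃‖ ≤ 1.461`,
  `1.333 ≤ ‖A₄‖ ≤ 2.139` against the certified `1.1377`, `1.4530`, `2.1325` (§ET1f-lite, kit j254878; the certified
  values approach the Hilbert–Schmidt end as `θ` grows).

References: M. Reed, B. Simon, *Methods of Modern Mathematical Physics I*, Thm VI.23 (Hilbert–Schmidt); [Su20] M. Suzuki,
ASPM 84 (2020) = arXiv:1907.07302, (1.4); DATA.md §ET1f-lite.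
-/

noncomputable section

-- D-0017: `Summit.<S>.<S>.…` is the designed namespace of a single-problem summit.
set_option linter.dupNamespace false

open MeasureTheory Set Filter Topology

namespace Summit.RiemannHypothesis.RiemannHypothesis.Theorems.SuzukiWindowsDoorWindowDilation

open Literature.Analysis.OperatorTheory
open Summit.RiemannHypothesis.RiemannHypothesis.Theorems.SuzukiWindowsDoorTempleGalerkin
open Summit.RiemannHypothesis.RiemannHypothesis.Theorems.SuzukiWindowsDoorExplicitOpNorm

/-! ## §1 Window operators through plain functions; the dilation `x = t·u` -/

section Plain

variable {K : ℝ → ℝ} {t : ℝ}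
  {A : Lp ℝ 2 (volume.restrict (Ioo (-t) t)) →L[ℝ] Lp ℝ 2 (volume.restrict (Ioo (-t) t))}

/-- RH-FREE, K-general.  A bounded realisation bounds the plain quadratic quantity:
`∫_S (∫_S K(x+y)f(y)dy)² dx ≤ ‖A‖² ∫_S f²` for every `f ∈ ℒ²(S)`. -/
theorem sq_integral_winOp_le
    (hA : ∀ φ, (A φ : ℝ → ℝ) =ᵐ[volume.restrict (Ioo (-t) t)] fun x => ∫ y in Ioo (-t) t, K (x + y) * φ y)
    {f : ℝ → ℝ} (hf : MemLp f 2 (volume.restrict (Ioo (-t) t))) :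
    ∫ x in Ioo (-t) t, (∫ y in Ioo (-t) t, K (x + y) * f y) ^ 2 ≤ ‖A‖ ^ 2 * ∫ x in Ioo (-t) t, f x ^ 2 := by
  rw [← norm_winOp_toLp_sq hA hf, ← norm_toLp_sq hf, ← mul_pow]
  exact pow_le_pow_left₀ (norm_nonneg _) (A.le_opNorm _) 2

/-- RH-FREE, K-general.  Conversely, a bound on the plain quadratic quantity bounds the operator norm:
if `∫_S (∫_S K(x+y)f)² ≤ C² ∫_S f²` for every `f ∈ ℒ²(S)` (`C ≥ 0`), then `‖A‖ ≤ C`. -/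
theorem opNorm_winOp_le_of_forall
    (hA : ∀ φ, (A φ : ℝ → ℝ) =ᵐ[volume.restrict (Ioo (-t) t)] fun x => ∫ y in Ioo (-t) t, K (x + y) * φ y)
    {C : ℝ} (hC : 0 ≤ C)
    (h : ∀ f : ℝ → ℝ, MemLp f 2 (volume.restrict (Ioo (-t) t)) →
      ∫ x in Ioo (-t) t, (∫ y in Ioo (-t) t, K (x + y) * f y) ^ 2 ≤ C ^ 2 * ∫ x in Ioo (-t) t, f x ^ 2) :
    ‖A‖ ≤ C := by
  refine ContinuousLinearMap.opNorm_le_bound _ hC fun φ => ?_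
  have hf : MemLp (φ : ℝ → ℝ) 2 (volume.restrict (Ioo (-t) t)) := Lp.memLp φ
  have hφ : hf.toLp (φ : ℝ → ℝ) = φ := Lp.toLp_coeFn φ hf
  have h1 : ‖A φ‖ ^ 2 ≤ (C * ‖φ‖) ^ 2 := by
    rw [← hφ, norm_winOp_toLp_sq hA hf, mul_pow, norm_toLp_sq hf]
    exact h _ hf
  exact (pow_le_pow_iff_left₀ (norm_nonneg _) (by positivity) two_ne_zero).mp h1

/-- Set integrals over a window are interval integrals: `∫_{(a,b)} F = ∫_a^b F` (`a ≤ b`). -/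
theorem setIntegral_Ioo_eq_intervalIntegral {a b : ℝ} (hab : a ≤ b) (F : ℝ → ℝ) :
    ∫ x in Ioo a b, F x = ∫ x in a..b, F x := by
  rw [intervalIntegral.integral_of_le hab, integral_Ioc_eq_integral_Ioo]

/-- RH-FREE.  **Change of variables `x = c·u` on a window**: `∫_{(−s,s)} F(x) dx = c ∫_{(−s/c, s/c)} F(cu) du`
(`c > 0`; any `F`, no integrability needed). -/
theorem setIntegral_win_comp_mul {c : ℝ} (hc : 0 < c) (s : ℝ) (F : ℝ → ℝ) :
    ∫ x in Ioo (-s) s, F x = c * ∫ u in Ioo (-(s / c)) (s / c), F (c * u) := by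
  rcases le_or_gt s 0 with hs | hs
  · have h1 : Ioo (-s) s = ∅ := Ioo_eq_empty (by linarith)
    have h2 : Ioo (-(s / c)) (s / c) = ∅ := Ioo_eq_empty (by
      have : s / c ≤ 0 := div_nonpos_of_nonpos_of_nonneg hs hc.le
      linarith)
    rw [h1, h2, Measure.restrict_empty, integral_zero_measure, integral_zero_measure, mul_zero]
  · have hsc : 0 < s / c := div_pos hs hc
    rw [setIntegral_Ioo_eq_intervalIntegral (by linarith) F,
      setIntegral_Ioo_eq_intervalIntegral (by linarith) (fun u => F (c * u)),
      intervalIntegral.integral_comp_mul_left F hc.ne', smul_eq_mul, ← mul_assoc, mul_inv_cancel₀ hc.ne',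
      one_mul, show c * -(s / c) = -s by field_simp, show c * (s / c) = s by field_simp]

/-- RH-FREE.  **`ℒ²` under dilation**: `f ∈ ℒ²(−s,s) ⇒ (u ↦ f(cu)) ∈ ℒ²(−s/c, s/c)` (`c > 0`). -/
theorem memLp_comp_mul {c s : ℝ} (hc : 0 < c) {f : ℝ → ℝ} (hf : MemLp f 2 (volume.restrict (Ioo (-s) s))) :
    MemLp (fun u => f (c * u)) 2 (volume.restrict (Ioo (-(s / c)) (s / c))) := by
  have hpre : (fun u : ℝ => c * u) ⁻¹' Ioo (-s) s = Ioo (-(s / c)) (s / c) := by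
    rw [preimage_const_mul_Ioo₀ _ _ hc, neg_div]
  have hmp : MeasurePreserving (fun u : ℝ => c * u) (volume.restrict (Ioo (-(s / c)) (s / c)))
      (ENNReal.ofReal c⁻¹ • volume.restrict (Ioo (-s) s)) := by
    refine ⟨measurable_const_mul c, ?_⟩
    rw [← hpre, ← Measure.restrict_map (measurable_const_mul c) measurableSet_Ioo,
      Real.map_volume_mul_left hc.ne', Measure.restrict_smul, abs_of_pos (inv_pos.mpr hc)]
  exact (hf.smul_measure ENNReal.ofReal_ne_top).comp_measurePreserving hmp

/-- RH-FREE, K-general.  **DILATION LEMMA**: for `t > 0`, a window operator `A` on `L²(−t,t)` with kernel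
`K(x+y)` and a window operator `B` on `L²(−1,1)` with the dilated kernel `t·K(t(u+v))` have the same norm,
`‖A‖ = ‖B‖` (the substitution `x = tu`, `y = tv` is unitary up to the factor `√t` on both sides). -/
theorem opNorm_winOp_eq_dilate (ht : 0 < t)
    (hA : ∀ φ, (A φ : ℝ → ℝ) =ᵐ[volume.restrict (Ioo (-t) t)] fun x => ∫ y in Ioo (-t) t, K (x + y) * φ y)
    {B : Lp ℝ 2 (volume.restrict (Ioo (-1 : ℝ) 1)) →L[ℝ] Lp ℝ 2 (volume.restrict (Ioo (-1 : ℝ) 1))}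
    (hB : ∀ φ, (B φ : ℝ → ℝ) =ᵐ[volume.restrict (Ioo (-1 : ℝ) 1)]
      fun u => ∫ v in Ioo (-1 : ℝ) 1, t * K (t * (u + v)) * φ v) :
    ‖A‖ = ‖B‖ := by
  have ht0 : t ≠ 0 := ht.ne'
  -- the inner integrals transform: `∫_{(−t,t)} K(tu + y) f(y) dy = ∫_{(−1,1)} tK(t(u+v)) f(tv) dv`
  have hinner : ∀ (f : ℝ → ℝ) (u : ℝ),
      ∫ y in Ioo (-t) t, K (t * u + y) * f y = ∫ v in Ioo (-1 : ℝ) 1, t * K (t * (u + v)) * f (t * v) := by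
    intro f u
    rw [setIntegral_win_comp_mul ht t, div_self ht0, ← integral_const_mul]
    refine integral_congr_ae (Eventually.of_forall fun v => ?_)
    simp only [mul_add]; ring
  refine le_antisymm ?_ ?_
  · -- `‖A‖ ≤ ‖B‖`
    refine opNorm_winOp_le_of_forall hA (norm_nonneg B) fun f hf => ?_
    have hg : MemLp (fun u => f (t * u)) 2 (volume.restrict (Ioo (-1 : ℝ) 1)) := by
      have h := memLp_comp_mul ht hf
      rwa [div_self ht0] at h
    have h1 := sq_integral_winOp_le (K := fun w => t * K (t * w)) hB hg
    -- rewrite both sides of `h1` back to the window `(−t,t)`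
    have hL : ∫ x in Ioo (-t) t, (∫ y in Ioo (-t) t, K (x + y) * f y) ^ 2 =
        t * ∫ u in Ioo (-1 : ℝ) 1, (∫ v in Ioo (-1 : ℝ) 1, t * K (t * (u + v)) * f (t * v)) ^ 2 := by
      rw [setIntegral_win_comp_mul ht t, div_self ht0]
      congr 1
      refine integral_congr_ae (Eventually.of_forall fun u => ?_)
      simp only [hinner f u]
    have hR : ∫ x in Ioo (-t) t, f x ^ 2 = t * ∫ u in Ioo (-1 : ℝ) 1, f (t * u) ^ 2 := by
      rw [setIntegral_win_comp_mul ht t, div_self ht0]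
    rw [hL, hR, mul_left_comm]
    exact mul_le_mul_of_nonneg_left h1 ht.le
  · -- `‖B‖ ≤ ‖A‖`
    refine opNorm_winOp_le_of_forall (K := fun w => t * K (t * w)) hB (norm_nonneg A) fun g hg => ?_
    have hf : MemLp (fun x => g (t⁻¹ * x)) 2 (volume.restrict (Ioo (-t) t)) := by
      have h := memLp_comp_mul (inv_pos.mpr ht) hg
      rwa [div_inv_eq_mul, one_mul] at h
    have h1 := sq_integral_winOp_le hA hf
    have hgf : ∀ u : ℝ, g (t⁻¹ * (t * u)) = g u := fun u => by rw [inv_mul_cancel_left₀ ht0]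
    have hL : ∫ x in Ioo (-t) t, (∫ y in Ioo (-t) t, K (x + y) * g (t⁻¹ * y)) ^ 2 =
        t * ∫ u in Ioo (-1 : ℝ) 1, (∫ v in Ioo (-1 : ℝ) 1, t * K (t * (u + v)) * g v) ^ 2 := by
      rw [setIntegral_win_comp_mul ht t, div_self ht0]
      congr 1
      refine integral_congr_ae (Eventually.of_forall fun u => ?_)
      simp only [hinner (fun x => g (t⁻¹ * x)) u, hgf]
    have hR : ∫ x in Ioo (-t) t, g (t⁻¹ * x) ^ 2 = t * ∫ u in Ioo (-1 : ℝ) 1, g u ^ 2 := by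
      rw [setIntegral_win_comp_mul ht t, div_self ht0]
      simp only [hgf]
    rw [hL, hR, mul_left_comm] at h1
    exact le_of_mul_le_mul_left h1 ht

end Plain

/-! ## §2 The onset operator `A_θ`: explicit two-sided bounds `2^{2θ}/(θ²(2θ+1)) ≤ ‖A_θ‖² ≤ 2^{2θ}/((2θ−1)2θ)` -/

section Onset

variable {k : ℕ}
  {B : Lp ℝ 2 (volume.restrict (Ioo (-1 : ℝ) 1)) →L[ℝ] Lp ℝ 2 (volume.restrict (Ioo (-1 : ℝ) 1))}

/-- `∫_{(−1,1)} (u+v)₊^k dv = (u+1)^{k+1}/(k+1)` for `|u| ≤ 1` (`k ≥ 1`). -/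
theorem integral_onsetKernel_row (hk : 1 ≤ k) {u : ℝ} (hu : u ∈ Icc (-1 : ℝ) 1) :
    ∫ v in Ioo (-1 : ℝ) 1, (max (u + v) 0) ^ k = (u + 1) ^ (k + 1) / ((k : ℝ) + 1) := by
  have hu1 : u + -1 ≤ 0 := by linarith [hu.2]
  have hu2 : 0 ≤ u + 1 := by linarith [hu.1]
  have hcont : Continuous fun w : ℝ => (max w 0) ^ k := (continuous_id.max continuous_const).pow k
  rw [setIntegral_Ioo_eq_intervalIntegral (by norm_num) (fun v => (max (u + v) 0) ^ k),
    intervalIntegral.integral_comp_add_left (fun w => (max w 0) ^ k) u,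
    ← intervalIntegral.integral_add_adjacent_intervals (b := 0) (hcont.intervalIntegrable _ _)
      (hcont.intervalIntegrable _ _)]
  have h1 : ∫ w in (u + -1)..0, (max w 0) ^ k = 0 := by
    have h : ∫ w in (u + -1)..0, (max w 0) ^ k = ∫ _ in (u + -1)..(0 : ℝ), (0 : ℝ) := by
      refine intervalIntegral.integral_congr fun w hw => ?_
      rw [uIcc_of_le hu1] at hw
      simp only [max_eq_right hw.2, zero_pow (by omega : k ≠ 0)]
    rw [h, intervalIntegral.integral_zero]
  have h2 : ∫ w in (0 : ℝ)..(u + 1), (max w 0) ^ k = (u + 1) ^ (k + 1) / ((k : ℝ) + 1) := by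
    rw [← show ∫ w in (0 : ℝ)..(u + 1), w ^ k = (u + 1) ^ (k + 1) / ((k : ℝ) + 1) by
      rw [integral_pow]; simp]
    refine intervalIntegral.integral_congr fun w hw => ?_
    rw [uIcc_of_le hu2] at hw
    simp only [max_eq_left hw.1]
  rw [h1, h2, zero_add]

/-- RH-FREE · **lower bound for the onset operator**: any bounded realisation `B` of `A_θ` (kernel `(u+v)₊^k` on
`L²(−1,1)`, `θ = k+1 ≥ 2`) has `‖B‖² ≥ 2^{2k+2}/((k+1)²(2k+3))` (test function `𝟙`:
`‖A_θ𝟙‖²/‖𝟙‖² = ½∫_{−1}^{1}((u+1)^θ/θ)² du`).  E.g. `‖A₂‖ ≥ 0.894` (certified `1.1377`, DATA §ET1f-lite). -/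
theorem sq_opNorm_onsetOp_ge (hk : 1 ≤ k)
    (hB : ∀ φ, (B φ : ℝ → ℝ) =ᵐ[volume.restrict (Ioo (-1 : ℝ) 1)]
      fun u => ∫ v in Ioo (-1 : ℝ) 1, (max (u + v) 0) ^ k * φ v) :
    (2 : ℝ) ^ (2 * k + 2) / (((k : ℝ) + 1) ^ 2 * (2 * (k : ℝ) + 3)) ≤ ‖B‖ ^ 2 := by
  have hk0 : (0 : ℝ) ≤ k := Nat.cast_nonneg k
  have hone : MemLp (fun _ : ℝ => (1 : ℝ)) 2 (volume.restrict (Ioo (-1 : ℝ) 1)) := memLp_const 1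
  have h := sq_integral_winOp_le (K := fun w => (max w 0) ^ k) hB hone
  -- the rows
  have hrow : ∀ u ∈ Ioo (-1 : ℝ) 1, (∫ v in Ioo (-1 : ℝ) 1, (max (u + v) 0) ^ k * (1 : ℝ)) =
      (u + 1) ^ (k + 1) / ((k : ℝ) + 1) := fun u hu => by
    simp only [mul_one]
    exact integral_onsetKernel_row hk (Ioo_subset_Icc_self hu)
  have hL : ∫ u in Ioo (-1 : ℝ) 1, (∫ v in Ioo (-1 : ℝ) 1, (max (u + v) 0) ^ k * (1 : ℝ)) ^ 2 =
      (2 : ℝ) ^ (2 * k + 3) / (((k : ℝ) + 1) ^ 2 * (2 * (k : ℝ) + 3)) := by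
    rw [setIntegral_congr_fun measurableSet_Ioo fun u hu => by rw [hrow u hu],
      setIntegral_Ioo_eq_intervalIntegral (by norm_num)]
    have hf : (fun u : ℝ => ((u + 1) ^ (k + 1) / ((k : ℝ) + 1)) ^ 2) =
        fun u : ℝ => (((k : ℝ) + 1) ^ 2)⁻¹ * (u + 1) ^ (2 * k + 2) := by
      funext u; rw [div_pow, ← pow_mul, show (k + 1) * 2 = 2 * k + 2 by ring]; ring
    rw [hf, intervalIntegral.integral_const_mul,
      intervalIntegral.integral_comp_add_right (fun w => w ^ (2 * k + 2)) (1 : ℝ), integral_pow]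
    norm_num
    rw [show ((2 : ℝ) * k + 2 + 1) = 2 * k + 3 by ring]
    field_simp
  have hR : ∫ u in Ioo (-1 : ℝ) 1, (fun _ : ℝ => (1 : ℝ)) u ^ 2 = 2 := by
    simp only [one_pow, setIntegral_const, Real.volume_real_Ioo_of_le (by norm_num : (-1 : ℝ) ≤ 1),
      smul_eq_mul, mul_one]
    norm_num
  rw [hL, hR] at h
  have h4 : (2 : ℝ) ^ (2 * k + 3) = 2 * 2 ^ (2 * k + 2) := by rw [pow_succ]; ring
  rw [h4, mul_div_assoc] at h
  linarith

/-- RH-FREE · **upper bound for the onset operator** (Hilbert–Schmidt): `‖B‖² ≤ ∫₀²(2−w)w^{2k}dw = 2^{2k+2}/((2k+1)(2k+2))`.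
E.g. `‖A₂‖ ≤ 1.155`, `‖A₃‖ ≤ 1.461`, `‖A₄‖ ≤ 2.139` (certified `1.1377`, `1.4530`, `2.1325`, DATA §ET1f-lite). -/
theorem sq_opNorm_onsetOp_le (hk : 1 ≤ k)
    (hB : ∀ φ, (B φ : ℝ → ℝ) =ᵐ[volume.restrict (Ioo (-1 : ℝ) 1)]
      fun u => ∫ v in Ioo (-1 : ℝ) 1, (max (u + v) 0) ^ k * φ v) :
    ‖B‖ ^ 2 ≤ (2 : ℝ) ^ (2 * k + 2) / ((2 * (k : ℝ) + 1) * (2 * (k : ℝ) + 2)) := by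
  have hk0 : (0 : ℝ) ≤ k := Nat.cast_nonneg k
  have hcont : Continuous fun w : ℝ => (max w 0) ^ k := (continuous_id.max continuous_const).pow k
  have h0 : ∀ u : ℝ, u < 0 → (max u 0) ^ k = 0 := fun u hu => by
    rw [max_eq_right hu.le, zero_pow (by omega)]
  have h := opNorm_winOp_le_sqrt_weightedSq (t := 1) hcont h0 one_pos hB
  have hI : ∫ u in (0 : ℝ)..(2 * 1), (2 * 1 - u) * ((max u 0) ^ k) ^ 2 =
      (2 : ℝ) ^ (2 * k + 2) / ((2 * (k : ℝ) + 1) * (2 * (k : ℝ) + 2)) := by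
    have hc : ∫ u in (0 : ℝ)..(2 * 1), (2 * 1 - u) * ((max u 0) ^ k) ^ 2 =
        ∫ u in (0 : ℝ)..2, (2 * u ^ (2 * k) - u ^ (2 * k + 1)) := by
      rw [show (2 : ℝ) * 1 = 2 by norm_num]
      refine intervalIntegral.integral_congr fun u hu => ?_
      rw [uIcc_of_le (by norm_num : (0 : ℝ) ≤ 2)] at hu
      simp only [max_eq_left hu.1]
      ring
    rw [hc, intervalIntegral.integral_sub (Continuous.intervalIntegrable (by fun_prop) _ _)
        (Continuous.intervalIntegrable (by fun_prop) _ _), intervalIntegral.integral_const_mul,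
      integral_pow, integral_pow]
    norm_num
    rw [show ((2 : ℝ) * k + 1 + 1) = 2 * k + 2 by ring]
    field_simp
    ring
  have hI0 : 0 ≤ (2 : ℝ) ^ (2 * k + 2) / ((2 * (k : ℝ) + 1) * (2 * (k : ℝ) + 2)) := by positivity
  rw [hI] at h
  calc ‖B‖ ^ 2 ≤ (Real.sqrt ((2 : ℝ) ^ (2 * k + 2) / ((2 * (k : ℝ) + 1) * (2 * (k : ℝ) + 2)))) ^ 2 :=
        pow_le_pow_left₀ (norm_nonneg _) h 2
    _ = (2 : ℝ) ^ (2 * k + 2) / ((2 * (k : ℝ) + 1) * (2 * (k : ℝ) + 2)) := Real.sq_sqrt hI0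

end Onset

end Summit.RiemannHypothesis.RiemannHypothesis.Theorems.SuzukiWindowsDoorWindowDilation

end
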